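import Mathlib
import Summits.Ventures.HodgeRepro.Tier4.Common.ArchAssemble
import Summits.Ventures.HodgeRepro.Tier4.Common.ArchAssembleProd
import Summits.Ventures.HodgeRepro.Tier4.Line4.ArchFactorProd
import Summits.Ventures.HodgeRepro.Tier4.Line4.TorusWeightLocal
import Summits.Ventures.HodgeRepro.Tier4.Line4.ArchWitnessAssembly

/-!
# Tier4/Line4/ArchMatching — the `arch_ne` matching `χ′ = Wt` on ALL of `T′_∞` from the display's own per-place binders
`_hchi' : ∀ w, ChiMatchesAt' … (eP′ w) (eM′ w) R.chi'`, through the place split `T′_∞ = ∏_w T′_w` (typer-2's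
`Common/ArchAssemble` + `Common/ArchAssembleProd`) — so `archFactor ≠ 0` for the product witnesses rests on the ONE
displayed clause (the `T_∞`-Fourier coefficient) and nothing asked

Blind re-derivation cell `pub-hodge-repro`, Tier 4 (README §9–§10), seat t4-L1-p5 (prover, gen 5; S15317 (b); typer-2
S15313 / S15322 / S15345, plan-4's GO S15328).  Target tree path `lean/Summits/Ventures/HodgeRepro/Tier4/Line4/ArchMatching.lean`.
On typer-2's `Common/ArchAssemble` (p706585: `ofPlace`, `ofPlace_mem_torusT'`, `ofPlace_mem_localTorusAt'`) and
`Common/ArchAssembleProd` (`map_eq_prod_ofPlace_of_mem_infinitePart`: a function multiplicative on a subgroup `H`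
containing the place projections of `g ∈ G_∞` satisfies `f g = ∏_w f (ofPlace w g)`), the seat's `TorusWeightLocal`
(`chi'_eq_torusWeight'_of_chiMatchesAt'`, `torusWeight'_mul`, `torusWeight'_one`) and `ArchFactorProd` (p706229);
no printed input.

WHAT IS PROVED (kernel, no print): `chi'Fun R` (`χ′` extended by `1` off `T′(𝔸)`; `chi'Fun_coe`, `chi'Fun_mul_of_mem`,
`chi'Fun_one` — `χ′(1) = 1` from `chi'_rational` at the rational point `1`); **`chi'_eq_torusWeight'_of_forall_chiMatchesAt'`**:
`(∀ w, ChiMatchesAt' W q w g g' (eP′ w) (eM′ w) R.chi') → ∀ t′ : torusInf' W, R.chi' t′ = torusWeight' eP′ eM′ t′`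
(both sides are multiplicative on `T′(𝔸)`, both split over the places of `t′ ∈ T′_∞`, and they agree on every `T′_w`);
**`archFactor_archWitness_ne_zero_of_chiMatchesAt'` / `archFactor_archWitness'_ne_zero_of_chiMatchesAt'`**: the
`arch_ne` field of `IsArchCoeff` for the product witnesses from the display's `_hchi'`, `ν′(T′_∞) ≠ 0`, and the ONE
displayed Fourier clause `∫_{T_∞} χ(t) · archWitness(t⁻¹ γ₀) dν ≠ 0`; `toReal_measure_univ_ne_zero_of_isHaarMeasure` and the
`_haar` forms with `ν′(T′_∞) ≠ 0` discharged from `[CompactSpace (torusInf' W)] [ν′.IsHaarMeasure]`; and the FINAL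
**`d3CoeffData'_archWitness(')_of_fourier`**: `L1Class.D3CoeffData' …` from the kernel data + `_hchi'` + the THREE prints `hinf`,
`hF`, `hpseudo`/`hpseudo'` — display (7a)'s conclusion with `arch_ne` no longer a print but the one Fourier clause.

Nothing here says anything about the status of the Hodge conjecture for CM abelian varieties, which is NOT proved
(HC_CM is NOT proved by anyone in this repository).
-/

set_option autoImplicit false

noncomputable section

namespace Summit.Ventures.HodgeRepro.Tier4.Line4

open Summit.Ventures.HodgeRepro.Tier4.Common Summit.Ventures.HodgeRepro.Tier4.Line1 NumberField Matrix MeasureTheory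

open scoped ComplexConjugate

open scoped Classical

section Matching

variable {k : Type} [Field k] [NumberField k] (q : QuadData k) (a : Fin 4 → k)
  (g g' : Matrix (Fin 4) (Fin 4) k) (hgg' : g * g' = 1) (hg'g : g' * g = 1)
  (hgΩ : g * (PlaneData.mixedRow q (a 0) (a 2)).Ω = (PlaneData.mixedRow q (a 0) (a 2)).Ω * g)
  (lam : k) (hlam : lam ≠ 0)
  (hiso : g * (PlaneData.mixedRow q (a 1) (a 3)).B * gᵀ = lam • (PlaneData.mixedRow q (a 0) (a 2)).B)
  [MeasurableSpace (GA ((PlaneData.mixedRow q (a 0) (a 2)).withTransportedTorus g g' hgg' hg'g hgΩ))]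
  (R : RTFData ((PlaneData.mixedRow q (a 0) (a 2)).withTransportedTorus g g' hgg' hg'g hgΩ))
  (eP' eM' : InfinitePlace k → ℤ)

/-- **`χ′` extended by `1` off `T′(𝔸)`** (a function on `G(𝔸)`, multiplicative on the subgroup `T′(𝔸)`). -/
def chi'Fun (x : GA ((PlaneData.mixedRow q (a 0) (a 2)).withTransportedTorus g g' hgg' hg'g hgΩ)) : ℂ :=
  if h : x ∈ torusT' ((PlaneData.mixedRow q (a 0) (a 2)).withTransportedTorus g g' hgg' hg'g hgΩ) then R.chi' ⟨x, h⟩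
  else 1

/-- `chi'Fun` on the torus is `χ′`. -/
theorem chi'Fun_coe (t : torusT' ((PlaneData.mixedRow q (a 0) (a 2)).withTransportedTorus g g' hgg' hg'g hgΩ)) :
    chi'Fun q a g g' hgg' hg'g hgΩ R (t : GA ((PlaneData.mixedRow q (a 0) (a 2)).withTransportedTorus g g' hgg' hg'g hgΩ)) =
      R.chi' t := by
  rw [chi'Fun, dif_pos t.2]

/-- `chi'Fun` is multiplicative on `T′(𝔸)`. -/
theorem chi'Fun_mul_of_mem {x y : GA ((PlaneData.mixedRow q (a 0) (a 2)).withTransportedTorus g g' hgg' hg'g hgΩ)}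
    (hx : x ∈ torusT' ((PlaneData.mixedRow q (a 0) (a 2)).withTransportedTorus g g' hgg' hg'g hgΩ))
    (hy : y ∈ torusT' ((PlaneData.mixedRow q (a 0) (a 2)).withTransportedTorus g g' hgg' hg'g hgΩ)) :
    chi'Fun q a g g' hgg' hg'g hgΩ R (x * y) =
      chi'Fun q a g g' hgg' hg'g hgΩ R x * chi'Fun q a g g' hgg' hg'g hgΩ R y := by
  rw [chi'Fun, dif_pos (mul_mem hx hy), chi'Fun, dif_pos hx, chi'Fun, dif_pos hy]
  exact R.chi'_mul ⟨x, hx⟩ ⟨y, hy⟩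

/-- `chi'Fun 1 = 1` (`χ′` is trivial on `T′(k) ∋ 1`). -/
theorem chi'Fun_one : chi'Fun q a g g' hgg' hg'g hgΩ R 1 = 1 := by
  rw [chi'Fun, dif_pos (one_mem _)]
  exact R.chi'_rational 1 (one_mem _)

include lam hlam hiso in
/-- **THE MATCHING ON `T′_∞` FROM THE PER-PLACE BINDERS**: if `ChiMatchesAt' W q w g g' (eP′ w) (eM′ w) R.chi'` at every
infinite place `w` (the display's `_hchi'`), then `R.chi' t′ = torusWeight' eP′ eM′ t′` for every `t′ ∈ T′_∞` — both sides
are multiplicative on `T′(𝔸)` and split over the places (`map_eq_prod_ofPlace_of_mem_infinitePart`), and they agree on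
each local torus (`chi'_eq_torusWeight'_of_chiMatchesAt'`). -/
theorem chi'_eq_torusWeight'_of_forall_chiMatchesAt' (hall : ∀ w : InfinitePlace k, w.IsReal ∧ IsCMAt q w)
    (ha1 : a 1 ≠ 0) (ha3 : a 3 ≠ 0)
    (h : ∀ w : InfinitePlace k, ChiMatchesAt' ((PlaneData.mixedRow q (a 0) (a 2)).withTransportedTorus g g' hgg' hg'g hgΩ)
      q w g g' (eP' w) (eM' w) R.chi')
    (t' : torusInf' ((PlaneData.mixedRow q (a 0) (a 2)).withTransportedTorus g g' hgg' hg'g hgΩ)) :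
    R.chi' t' = torusWeight' q a g g' hgg' hg'g hgΩ eP' eM'
      ((t' : torusT' ((PlaneData.mixedRow q (a 0) (a 2)).withTransportedTorus g g' hgg' hg'g hgΩ)) :
        GA ((PlaneData.mixedRow q (a 0) (a 2)).withTransportedTorus g g' hgg' hg'g hgΩ)) := by
  have hT : ((t' : torusT' ((PlaneData.mixedRow q (a 0) (a 2)).withTransportedTorus g g' hgg' hg'g hgΩ)) :
      GA ((PlaneData.mixedRow q (a 0) (a 2)).withTransportedTorus g g' hgg' hg'g hgΩ)) ∈
      torusT' ((PlaneData.mixedRow q (a 0) (a 2)).withTransportedTorus g g' hgg' hg'g hgΩ) :=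
    (t' : torusT' ((PlaneData.mixedRow q (a 0) (a 2)).withTransportedTorus g g' hgg' hg'g hgΩ)).2
  have hinf : ((t' : torusT' ((PlaneData.mixedRow q (a 0) (a 2)).withTransportedTorus g g' hgg' hg'g hgΩ)) :
      GA ((PlaneData.mixedRow q (a 0) (a 2)).withTransportedTorus g g' hgg' hg'g hgΩ)) ∈
      infinitePart ((PlaneData.mixedRow q (a 0) (a 2)).withTransportedTorus g g' hgg' hg'g hgΩ) :=
    Subgroup.mem_subgroupOf.1 t'.2
  have hw : ∀ w : InfinitePlace k,
      ofPlace ((PlaneData.mixedRow q (a 0) (a 2)).withTransportedTorus g g' hgg' hg'g hgΩ) w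
        ((t' : torusT' ((PlaneData.mixedRow q (a 0) (a 2)).withTransportedTorus g g' hgg' hg'g hgΩ)) :
          GA ((PlaneData.mixedRow q (a 0) (a 2)).withTransportedTorus g g' hgg' hg'g hgΩ)) ∈
        torusT' ((PlaneData.mixedRow q (a 0) (a 2)).withTransportedTorus g g' hgg' hg'g hgΩ) :=
    fun w => ofPlace_mem_torusT' _ w hT
  have h1 := map_eq_prod_ofPlace_of_mem_infinitePart
    ((PlaneData.mixedRow q (a 0) (a 2)).withTransportedTorus g g' hgg' hg'g hgΩ)
    (torusT' ((PlaneData.mixedRow q (a 0) (a 2)).withTransportedTorus g g' hgg' hg'g hgΩ))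
    (chi'Fun q a g g' hgg' hg'g hgΩ R)
    (fun _ hx _ hy => chi'Fun_mul_of_mem q a g g' hgg' hg'g hgΩ R hx hy) (chi'Fun_one q a g g' hgg' hg'g hgΩ R) hinf hw
  have h2 := map_eq_prod_ofPlace_of_mem_infinitePart
    ((PlaneData.mixedRow q (a 0) (a 2)).withTransportedTorus g g' hgg' hg'g hgΩ)
    (torusT' ((PlaneData.mixedRow q (a 0) (a 2)).withTransportedTorus g g' hgg' hg'g hgΩ))
    (torusWeight' q a g g' hgg' hg'g hgΩ eP' eM')
    (fun _ hx _ hy => torusWeight'_mul q a g g' hgg' hg'g hgΩ lam hlam hiso hall ha1 ha3 eP' eM' hx hy)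
    (torusWeight'_one q a g g' hgg' hg'g hgΩ lam hiso eP' eM') hinf hw
  rw [← chi'Fun_coe, h1, h2]
  refine Finset.prod_congr rfl fun w _ => ?_
  rw [chi'Fun, dif_pos (hw w)]
  exact chi'_eq_torusWeight'_of_chiMatchesAt' q a g g' hgg' hg'g hgΩ lam hlam hiso R eP' eM' (h w)
    (ofPlace_mem_localTorusAt' _ w hT)

include hlam in
/-- **`arch_ne` FOR `archWitness` FROM THE DISPLAY'S BINDERS**: every infinite place real CM, `a 1 ≠ 0 ≠ a 3`,
`eP′ w₀ = eM′ w₀ + 3`, the per-place matching `_hchi'`, `ν′(T′_∞) ≠ 0`, and the ONE displayed Fourier clause. -/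
theorem archFactor_archWitness_ne_zero_of_chiMatchesAt' (hall : ∀ w : InfinitePlace k, w.IsReal ∧ IsCMAt q w)
    (ha1 : a 1 ≠ 0) (ha3 : a 3 ≠ 0) (w₀ : InfinitePlace k) (he : eP' w₀ = eM' w₀ + 3)
    (h : ∀ w : InfinitePlace k, ChiMatchesAt' ((PlaneData.mixedRow q (a 0) (a 2)).withTransportedTorus g g' hgg' hg'g hgΩ)
      q w g g' (eP' w) (eM' w) R.chi')
    (γ₀ : GA ((PlaneData.mixedRow q (a 0) (a 2)).withTransportedTorus g g' hgg' hg'g hgΩ))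
    (νinf : Measure (torusInf ((PlaneData.mixedRow q (a 0) (a 2)).withTransportedTorus g g' hgg' hg'g hgΩ)))
    (νinf' : Measure (torusInf' ((PlaneData.mixedRow q (a 0) (a 2)).withTransportedTorus g g' hgg' hg'g hgΩ)))
    (hvol : (νinf' Set.univ).toReal ≠ 0)
    (hF : (∫ t : torusInf ((PlaneData.mixedRow q (a 0) (a 2)).withTransportedTorus g g' hgg' hg'g hgΩ),
        R.chi t * archWitness q a g g' hgg' hg'g hgΩ lam hiso w₀ eP' eM'
          (((t : torusT ((PlaneData.mixedRow q (a 0) (a 2)).withTransportedTorus g g' hgg' hg'g hgΩ)) :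
            GA ((PlaneData.mixedRow q (a 0) (a 2)).withTransportedTorus g g' hgg' hg'g hgΩ))⁻¹ * γ₀) ∂νinf) ≠ 0) :
    L1Class.archFactor ((PlaneData.mixedRow q (a 0) (a 2)).withTransportedTorus g g' hgg' hg'g hgΩ) R
      (archWitness q a g g' hgg' hg'g hgΩ lam hiso w₀ eP' eM') γ₀ νinf νinf' ≠ 0 :=
  archFactor_archWitness_ne_zero q a g g' hgg' hg'g hgΩ lam hlam hiso R w₀ eP' eM' γ₀ νinf νinf' hall ha1 ha3 he
    (chi'_eq_torusWeight'_of_forall_chiMatchesAt' q a g g' hgg' hg'g hgΩ lam hlam hiso R eP' eM' hall ha1 ha3 h)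
    hvol hF

include hlam in
/-- **`arch_ne` FOR `archWitness'` FROM THE DISPLAY'S BINDERS** (`eM′ w₀ = eP′ w₀ + 3`). -/
theorem archFactor_archWitness'_ne_zero_of_chiMatchesAt' (hall : ∀ w : InfinitePlace k, w.IsReal ∧ IsCMAt q w)
    (ha1 : a 1 ≠ 0) (ha3 : a 3 ≠ 0) (w₀ : InfinitePlace k) (he : eM' w₀ = eP' w₀ + 3)
    (h : ∀ w : InfinitePlace k, ChiMatchesAt' ((PlaneData.mixedRow q (a 0) (a 2)).withTransportedTorus g g' hgg' hg'g hgΩ)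
      q w g g' (eP' w) (eM' w) R.chi')
    (γ₀ : GA ((PlaneData.mixedRow q (a 0) (a 2)).withTransportedTorus g g' hgg' hg'g hgΩ))
    (νinf : Measure (torusInf ((PlaneData.mixedRow q (a 0) (a 2)).withTransportedTorus g g' hgg' hg'g hgΩ)))
    (νinf' : Measure (torusInf' ((PlaneData.mixedRow q (a 0) (a 2)).withTransportedTorus g g' hgg' hg'g hgΩ)))
    (hvol : (νinf' Set.univ).toReal ≠ 0)
    (hF : (∫ t : torusInf ((PlaneData.mixedRow q (a 0) (a 2)).withTransportedTorus g g' hgg' hg'g hgΩ),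
        R.chi t * archWitness' q a g g' hgg' hg'g hgΩ lam hiso w₀ eP' eM'
          (((t : torusT ((PlaneData.mixedRow q (a 0) (a 2)).withTransportedTorus g g' hgg' hg'g hgΩ)) :
            GA ((PlaneData.mixedRow q (a 0) (a 2)).withTransportedTorus g g' hgg' hg'g hgΩ))⁻¹ * γ₀) ∂νinf) ≠ 0) :
    L1Class.archFactor ((PlaneData.mixedRow q (a 0) (a 2)).withTransportedTorus g g' hgg' hg'g hgΩ) R
      (archWitness' q a g g' hgg' hg'g hgΩ lam hiso w₀ eP' eM') γ₀ νinf νinf' ≠ 0 :=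
  archFactor_archWitness'_ne_zero q a g g' hgg' hg'g hgΩ lam hlam hiso R w₀ eP' eM' γ₀ νinf νinf' hall ha1 ha3 he
    (chi'_eq_torusWeight'_of_forall_chiMatchesAt' q a g g' hgg' hg'g hgΩ lam hlam hiso R eP' eM' hall ha1 ha3 h)
    hvol hF

/-- **a Haar measure on a compact group has positive finite total mass**: `(μ univ).toReal ≠ 0`. -/
theorem toReal_measure_univ_ne_zero_of_isHaarMeasure {X : Type} [TopologicalSpace X] [Group X] [MeasurableSpace X]
    [CompactSpace X] (μ : Measure X) [μ.IsHaarMeasure] : (μ Set.univ).toReal ≠ 0 := by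
  haveI : Nonempty X := ⟨1⟩
  have h0 : μ Set.univ ≠ 0 := isOpen_univ.measure_ne_zero μ Set.univ_nonempty
  have h1 : μ Set.univ ≠ ⊤ := (IsCompact.measure_lt_top isCompact_univ).ne
  exact (ENNReal.toReal_pos h0 h1).ne'

include hlam in
/-- **`arch_ne` FOR `archWitness` WITH `hvol` DISCHARGED**: `T′_∞` compact and `ν′` Haar give `ν′(T′_∞) ≠ 0` by name. -/
theorem archFactor_archWitness_ne_zero_of_chiMatchesAt'_haar (hall : ∀ w : InfinitePlace k, w.IsReal ∧ IsCMAt q w)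
    (ha1 : a 1 ≠ 0) (ha3 : a 3 ≠ 0) (w₀ : InfinitePlace k) (he : eP' w₀ = eM' w₀ + 3)
    (h : ∀ w : InfinitePlace k, ChiMatchesAt' ((PlaneData.mixedRow q (a 0) (a 2)).withTransportedTorus g g' hgg' hg'g hgΩ)
      q w g g' (eP' w) (eM' w) R.chi')
    (γ₀ : GA ((PlaneData.mixedRow q (a 0) (a 2)).withTransportedTorus g g' hgg' hg'g hgΩ))
    (νinf : Measure (torusInf ((PlaneData.mixedRow q (a 0) (a 2)).withTransportedTorus g g' hgg' hg'g hgΩ)))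
    [CompactSpace (torusInf' ((PlaneData.mixedRow q (a 0) (a 2)).withTransportedTorus g g' hgg' hg'g hgΩ))]
    (νinf' : Measure (torusInf' ((PlaneData.mixedRow q (a 0) (a 2)).withTransportedTorus g g' hgg' hg'g hgΩ)))
    [νinf'.IsHaarMeasure]
    (hF : (∫ t : torusInf ((PlaneData.mixedRow q (a 0) (a 2)).withTransportedTorus g g' hgg' hg'g hgΩ),
        R.chi t * archWitness q a g g' hgg' hg'g hgΩ lam hiso w₀ eP' eM'
          (((t : torusT ((PlaneData.mixedRow q (a 0) (a 2)).withTransportedTorus g g' hgg' hg'g hgΩ)) :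
            GA ((PlaneData.mixedRow q (a 0) (a 2)).withTransportedTorus g g' hgg' hg'g hgΩ))⁻¹ * γ₀) ∂νinf) ≠ 0) :
    L1Class.archFactor ((PlaneData.mixedRow q (a 0) (a 2)).withTransportedTorus g g' hgg' hg'g hgΩ) R
      (archWitness q a g g' hgg' hg'g hgΩ lam hiso w₀ eP' eM') γ₀ νinf νinf' ≠ 0 :=
  archFactor_archWitness_ne_zero_of_chiMatchesAt' q a g g' hgg' hg'g hgΩ lam hlam hiso R eP' eM' hall ha1 ha3 w₀ he h
    γ₀ νinf νinf' (toReal_measure_univ_ne_zero_of_isHaarMeasure νinf') hF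

include hlam in
/-- **`arch_ne` FOR `archWitness'` WITH `hvol` DISCHARGED**. -/
theorem archFactor_archWitness'_ne_zero_of_chiMatchesAt'_haar (hall : ∀ w : InfinitePlace k, w.IsReal ∧ IsCMAt q w)
    (ha1 : a 1 ≠ 0) (ha3 : a 3 ≠ 0) (w₀ : InfinitePlace k) (he : eM' w₀ = eP' w₀ + 3)
    (h : ∀ w : InfinitePlace k, ChiMatchesAt' ((PlaneData.mixedRow q (a 0) (a 2)).withTransportedTorus g g' hgg' hg'g hgΩ)
      q w g g' (eP' w) (eM' w) R.chi')
    (γ₀ : GA ((PlaneData.mixedRow q (a 0) (a 2)).withTransportedTorus g g' hgg' hg'g hgΩ))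
    (νinf : Measure (torusInf ((PlaneData.mixedRow q (a 0) (a 2)).withTransportedTorus g g' hgg' hg'g hgΩ)))
    [CompactSpace (torusInf' ((PlaneData.mixedRow q (a 0) (a 2)).withTransportedTorus g g' hgg' hg'g hgΩ))]
    (νinf' : Measure (torusInf' ((PlaneData.mixedRow q (a 0) (a 2)).withTransportedTorus g g' hgg' hg'g hgΩ)))
    [νinf'.IsHaarMeasure]
    (hF : (∫ t : torusInf ((PlaneData.mixedRow q (a 0) (a 2)).withTransportedTorus g g' hgg' hg'g hgΩ),
        R.chi t * archWitness' q a g g' hgg' hg'g hgΩ lam hiso w₀ eP' eM'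
          (((t : torusT ((PlaneData.mixedRow q (a 0) (a 2)).withTransportedTorus g g' hgg' hg'g hgΩ)) :
            GA ((PlaneData.mixedRow q (a 0) (a 2)).withTransportedTorus g g' hgg' hg'g hgΩ))⁻¹ * γ₀) ∂νinf) ≠ 0) :
    L1Class.archFactor ((PlaneData.mixedRow q (a 0) (a 2)).withTransportedTorus g g' hgg' hg'g hgΩ) R
      (archWitness' q a g g' hgg' hg'g hgΩ lam hiso w₀ eP' eM') γ₀ νinf νinf' ≠ 0 :=
  archFactor_archWitness'_ne_zero_of_chiMatchesAt' q a g g' hgg' hg'g hgΩ lam hlam hiso R eP' eM' hall ha1 ha3 w₀ he h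
    γ₀ νinf νinf' (toReal_measure_univ_ne_zero_of_isHaarMeasure νinf') hF

end Matching

section Final

variable {k : Type} [Field k] [NumberField k] (q : QuadData k) (a : Fin 4 → k)
  (g g' : Matrix (Fin 4) (Fin 4) k) (hgg' : g * g' = 1) (hg'g : g' * g = 1)
  (hgΩ : g * (PlaneData.mixedRow q (a 0) (a 2)).Ω = (PlaneData.mixedRow q (a 0) (a 2)).Ω * g)
  (lam : k) (hlam : lam ≠ 0)
  (hiso : g * (PlaneData.mixedRow q (a 1) (a 3)).B * gᵀ = lam • (PlaneData.mixedRow q (a 0) (a 2)).B)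
  [MeasurableSpace (GA ((PlaneData.mixedRow q (a 0) (a 2)).withTransportedTorus g g' hgg' hg'g hgΩ))]
  [BorelSpace (GA ((PlaneData.mixedRow q (a 0) (a 2)).withTransportedTorus g g' hgg' hg'g hgΩ))]
  (S : RTF.Setting (GA ((PlaneData.mixedRow q (a 0) (a 2)).withTransportedTorus g g' hgg' hg'g hgΩ)))
  (R : RTFData ((PlaneData.mixedRow q (a 0) (a 2)).withTransportedTorus g g' hgg' hg'g hgΩ))
  (w₀ : InfinitePlace k) (eP eM eP' eM' : InfinitePlace k → ℤ)
  (γ₀ : GA ((PlaneData.mixedRow q (a 0) (a 2)).withTransportedTorus g g' hgg' hg'g hgΩ))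
  (νinf : Measure (torusInf ((PlaneData.mixedRow q (a 0) (a 2)).withTransportedTorus g g' hgg' hg'g hgΩ)))
  (νinf' : Measure (torusInf' ((PlaneData.mixedRow q (a 0) (a 2)).withTransportedTorus g g' hgg' hg'g hgΩ)))

include hlam in
/-- **`D3CoeffData'` WITH `arch_ne` FROM THE DISPLAY'S OWN BINDERS** (holomorphic branch `eP′ w₀ = eM′ w₀ + 3`): the
witness `archWitness`; hypotheses = the kernel data (`w₀` real CM with the `U(1,1)` signs, every `w′ ≠ w₀` real CM and
definite, `_hchi'` per place, `T′_∞` compact, `ν′` Haar) + the THREE prints `hinf` (`G_∞`-integrability), `hF` (the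
`T_∞`-Fourier coefficient at the line's `γ₀`), `hpseudo` / `hpseudo'` (operator Schur). -/
theorem d3CoeffData'_archWitness_of_fourier [S.μ.IsHaarMeasure]
    (μinf : Measure (infinitePart ((PlaneData.mixedRow q (a 0) (a 2)).withTransportedTorus g g' hgg' hg'g hgΩ)))
    [μinf.IsHaarMeasure]
    [CompactSpace (torusInf' ((PlaneData.mixedRow q (a 0) (a 2)).withTransportedTorus g g' hgg' hg'g hgΩ))]
    [νinf'.IsHaarMeasure]
    (hall : ∀ w : InfinitePlace k, w.IsReal ∧ IsCMAt q w)
    (ha1 : 0 < (adToC w₀ (algebraMap k (Ad k) (a 1))).re) (ha3 : (adToC w₀ (algebraMap k (Ad k) (-1 * a 3))).re < 0)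
    (hdef : ∀ w' : InfinitePlace k, w' ≠ w₀ → w'.IsReal ∧ IsCMAt q w' ∧
      0 < (adToC w' (algebraMap k (Ad k) (a 1))).re * (adToC w' (algebraMap k (Ad k) (-1 * a 3))).re)
    (he : eP' w₀ = eM' w₀ + 3)
    (hchi' : ∀ w : InfinitePlace k, ChiMatchesAt' ((PlaneData.mixedRow q (a 0) (a 2)).withTransportedTorus g g' hgg' hg'g hgΩ)
      q w g g' (eP' w) (eM' w) R.chi')
    (hinf : Integrable (fun y : infinitePart ((PlaneData.mixedRow q (a 0) (a 2)).withTransportedTorus g g' hgg' hg'g hgΩ) =>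
      archWitness q a g g' hgg' hg'g hgΩ lam hiso w₀ eP' eM' y) μinf)
    (hF : (∫ t : torusInf ((PlaneData.mixedRow q (a 0) (a 2)).withTransportedTorus g g' hgg' hg'g hgΩ),
        R.chi t * archWitness q a g g' hgg' hg'g hgΩ lam hiso w₀ eP' eM'
          (((t : torusT ((PlaneData.mixedRow q (a 0) (a 2)).withTransportedTorus g g' hgg' hg'g hgΩ)) :
            GA ((PlaneData.mixedRow q (a 0) (a 2)).withTransportedTorus g g' hgg' hg'g hgΩ))⁻¹ * γ₀) ∂νinf) ≠ 0)
    (hpseudo : ∀ ffin : GA ((PlaneData.mixedRow q (a 0) (a 2)).withTransportedTorus g g' hgg' hg'g hgΩ) → ℂ,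
      L1Class.IsFinFactor ((PlaneData.mixedRow q (a 0) (a 2)).withTransportedTorus g g' hgg' hg'g hgΩ) ffin →
      IsPseudoCoeffAt ((PlaneData.mixedRow q (a 0) (a 2)).withTransportedTorus g g' hgg' hg'g hgΩ) S q w₀ eP eM
        (RTF.cj (L1Class.prodFn ((PlaneData.mixedRow q (a 0) (a 2)).withTransportedTorus g g' hgg' hg'g hgΩ)
          (archWitness q a g g' hgg' hg'g hgΩ lam hiso w₀ eP' eM') ffin)))
    (hpseudo' : ∀ ffin : GA ((PlaneData.mixedRow q (a 0) (a 2)).withTransportedTorus g g' hgg' hg'g hgΩ) → ℂ,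
      L1Class.IsFinFactor ((PlaneData.mixedRow q (a 0) (a 2)).withTransportedTorus g g' hgg' hg'g hgΩ) ffin →
      IsPseudoCoeffAt' ((PlaneData.mixedRow q (a 0) (a 2)).withTransportedTorus g g' hgg' hg'g hgΩ) S q g g' w₀ eP' eM'
        (RTF.cj (L1Class.prodFn ((PlaneData.mixedRow q (a 0) (a 2)).withTransportedTorus g g' hgg' hg'g hgΩ)
          (archWitness q a g g' hgg' hg'g hgΩ lam hiso w₀ eP' eM') ffin))) :
    L1Class.D3CoeffData' ((PlaneData.mixedRow q (a 0) (a 2)).withTransportedTorus g g' hgg' hg'g hgΩ) S R q g g' w₀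
      eP eM eP' eM' γ₀ νinf νinf' :=
  d3CoeffData'_archWitness q a g g' hgg' hg'g hgΩ lam hlam hiso S R w₀ eP eM eP' eM' γ₀ νinf νinf' μinf (hall w₀).1
    (hall w₀).2 ha1 ha3 hdef he hinf
    (archFactor_archWitness_ne_zero_of_chiMatchesAt'_haar q a g g' hgg' hg'g hgΩ lam hlam hiso R eP' eM' hall
      (a_one_ne_zero_of_pos a w₀ ha1) (a_three_ne_zero_of_neg a w₀ ha3) w₀ he hchi' γ₀ νinf νinf' hF)
    hpseudo hpseudo'

include hlam in
/-- **`D3CoeffData'` WITH `arch_ne` FROM THE DISPLAY'S OWN BINDERS** (antiholomorphic branch `eM′ w₀ = eP′ w₀ + 3`). -/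
theorem d3CoeffData'_archWitness'_of_fourier [S.μ.IsHaarMeasure]
    (μinf : Measure (infinitePart ((PlaneData.mixedRow q (a 0) (a 2)).withTransportedTorus g g' hgg' hg'g hgΩ)))
    [μinf.IsHaarMeasure]
    [CompactSpace (torusInf' ((PlaneData.mixedRow q (a 0) (a 2)).withTransportedTorus g g' hgg' hg'g hgΩ))]
    [νinf'.IsHaarMeasure]
    (hall : ∀ w : InfinitePlace k, w.IsReal ∧ IsCMAt q w)
    (ha1 : 0 < (adToC w₀ (algebraMap k (Ad k) (a 1))).re) (ha3 : (adToC w₀ (algebraMap k (Ad k) (-1 * a 3))).re < 0)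
    (hdef : ∀ w' : InfinitePlace k, w' ≠ w₀ → w'.IsReal ∧ IsCMAt q w' ∧
      0 < (adToC w' (algebraMap k (Ad k) (a 1))).re * (adToC w' (algebraMap k (Ad k) (-1 * a 3))).re)
    (he : eM' w₀ = eP' w₀ + 3)
    (hchi' : ∀ w : InfinitePlace k, ChiMatchesAt' ((PlaneData.mixedRow q (a 0) (a 2)).withTransportedTorus g g' hgg' hg'g hgΩ)
      q w g g' (eP' w) (eM' w) R.chi')
    (hinf : Integrable (fun y : infinitePart ((PlaneData.mixedRow q (a 0) (a 2)).withTransportedTorus g g' hgg' hg'g hgΩ) =>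
      archWitness' q a g g' hgg' hg'g hgΩ lam hiso w₀ eP' eM' y) μinf)
    (hF : (∫ t : torusInf ((PlaneData.mixedRow q (a 0) (a 2)).withTransportedTorus g g' hgg' hg'g hgΩ),
        R.chi t * archWitness' q a g g' hgg' hg'g hgΩ lam hiso w₀ eP' eM'
          (((t : torusT ((PlaneData.mixedRow q (a 0) (a 2)).withTransportedTorus g g' hgg' hg'g hgΩ)) :
            GA ((PlaneData.mixedRow q (a 0) (a 2)).withTransportedTorus g g' hgg' hg'g hgΩ))⁻¹ * γ₀) ∂νinf) ≠ 0)
    (hpseudo : ∀ ffin : GA ((PlaneData.mixedRow q (a 0) (a 2)).withTransportedTorus g g' hgg' hg'g hgΩ) → ℂ,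
      L1Class.IsFinFactor ((PlaneData.mixedRow q (a 0) (a 2)).withTransportedTorus g g' hgg' hg'g hgΩ) ffin →
      IsPseudoCoeffAt ((PlaneData.mixedRow q (a 0) (a 2)).withTransportedTorus g g' hgg' hg'g hgΩ) S q w₀ eP eM
        (RTF.cj (L1Class.prodFn ((PlaneData.mixedRow q (a 0) (a 2)).withTransportedTorus g g' hgg' hg'g hgΩ)
          (archWitness' q a g g' hgg' hg'g hgΩ lam hiso w₀ eP' eM') ffin)))
    (hpseudo' : ∀ ffin : GA ((PlaneData.mixedRow q (a 0) (a 2)).withTransportedTorus g g' hgg' hg'g hgΩ) → ℂ,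
      L1Class.IsFinFactor ((PlaneData.mixedRow q (a 0) (a 2)).withTransportedTorus g g' hgg' hg'g hgΩ) ffin →
      IsPseudoCoeffAt' ((PlaneData.mixedRow q (a 0) (a 2)).withTransportedTorus g g' hgg' hg'g hgΩ) S q g g' w₀ eP' eM'
        (RTF.cj (L1Class.prodFn ((PlaneData.mixedRow q (a 0) (a 2)).withTransportedTorus g g' hgg' hg'g hgΩ)
          (archWitness' q a g g' hgg' hg'g hgΩ lam hiso w₀ eP' eM') ffin))) :
    L1Class.D3CoeffData' ((PlaneData.mixedRow q (a 0) (a 2)).withTransportedTorus g g' hgg' hg'g hgΩ) S R q g g' w₀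
      eP eM eP' eM' γ₀ νinf νinf' :=
  d3CoeffData'_archWitness' q a g g' hgg' hg'g hgΩ lam hlam hiso S R w₀ eP eM eP' eM' γ₀ νinf νinf' μinf (hall w₀).1
    (hall w₀).2 ha1 ha3 hdef he hinf
    (archFactor_archWitness'_ne_zero_of_chiMatchesAt'_haar q a g g' hgg' hg'g hgΩ lam hlam hiso R eP' eM' hall
      (a_one_ne_zero_of_pos a w₀ ha1) (a_three_ne_zero_of_neg a w₀ ha3) w₀ he hchi' γ₀ νinf νinf' hF)
    hpseudo hpseudo'

end Final

end Summit.Ventures.HodgeRepro.Tier4.Line4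

end
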